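import Summits.ABC.ABC.Theses.RootDecompA
import HarnessLib

/-!
# Route RootDecompA — split glue `SmoothForgivenABCGlue5` (item stmt-ABC-27610)

`LopsidedForgivenABC → CheapHeavyForgivenABC → ShadowlessForgivenABC → ShadowedForgivenABC →
SmoothForgivenABC` (`Summit.ABC.ABC.Theses.RootDecompA.SmoothForgivenABCGlue5`): the four gen-5 children
of door A's forgiven piece reassemble it by a four-cell case tree — lopsided (`min(a,b) ≤ c^(1−δ)`:
piece L) / balanced and, for `δ < 1/3`, cheap-heavy (`c^δ ≤ S_{⌊rad^δ⌋}(abc)`: piece G_CH; for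
`δ ≥ 1/3` G_CH serves every balanced triple, its cheap-mass hypothesis being vacuous) / balanced
cheap-light shadowless (G_SL) / balanced cheap-light shadowed (G_SD) — with the level `y := max` of the
four levels (the `y`-smooth part `S_y(abc) = ∏_{p ≤ y} p^{ν_p(abc)}` is monotone in `y`) and the
constant `K := max` of the four constants (lens-3 gen-5 ShadowSplit; cell decomp-abc writer LANDING
LIST, door A).  Bookkeeping only (size S); proves neither `ABC` nor any crux, and does not touch the
declared residual `ShadowlessForgivenABC`.
-/

set_option linter.dupNamespace false

namespace Summit.ABC.ABC.Theorems

namespace RootDecompASmoothForgivenGlue5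

/-- The `y`-smooth part of `n` (primes `≤ y` with full multiplicity) is monotone in the level `y`. -/
private theorem smoothPart_mono (n : ℕ) {y y' : ℕ} (hy : y' ≤ y) :
    (∏ p ∈ n.primeFactors with p ≤ y', p ^ n.factorization p) ≤
      ∏ p ∈ n.primeFactors with p ≤ y, p ^ n.factorization p := by
  apply Finset.prod_le_prod_of_subset_of_one_le'
  · intro p hp
    simp only [Finset.mem_filter] at hp ⊢
    exact ⟨hp.1, hp.2.trans hy⟩
  · intro p hp _
    exact Nat.one_le_pow _ _ (Nat.prime_of_mem_primeFactors (Finset.mem_filter.mp hp).1).pos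

/-- Lifting a cell bound `c < K'·S'·R` to the common constant `K ≥ K'` and level (`S' ≤ S`). -/
private theorem lift {c K K' R : ℝ} {S S' : ℕ} (h : c < K' * (S' : ℝ) * R) (hK : K' ≤ K) (hK0 : 0 ≤ K)
    (hS : S' ≤ S) (hR : 0 ≤ R) : c < K * (S : ℝ) * R := by
  have hS' : (S' : ℝ) ≤ (S : ℝ) := by exact_mod_cast hS
  exact h.trans_le (mul_le_mul (mul_le_mul hK hS' (Nat.cast_nonneg _) hK0) le_rfl hR
    (mul_nonneg hK0 (Nat.cast_nonneg _)))

end RootDecompASmoothForgivenGlue5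

open RootDecompASmoothForgivenGlue5 in
/-- Item stmt-ABC-27610, literally the route decl `RootDecompA.SmoothForgivenABCGlue5`. -/
theorem rootDecompA_smoothForgivenABCGlue5_proof :
    Summit.ABC.ABC.Theses.RootDecompA.SmoothForgivenABCGlue5 := by
  unfold Summit.ABC.ABC.Theses.RootDecompA.SmoothForgivenABCGlue5
    Summit.ABC.ABC.Theses.RootDecompA.LopsidedForgivenABC
    Summit.ABC.ABC.Theses.RootDecompA.CheapHeavyForgivenABC
    Summit.ABC.ABC.Theses.RootDecompA.ShadowlessForgivenABC
    Summit.ABC.ABC.Theses.RootDecompA.ShadowedForgivenABC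
    Summit.ABC.ABC.Theses.RootDecompA.SmoothForgivenABC
  rintro ⟨yL, hL⟩ ⟨yH, hH⟩ ⟨yS, hS⟩ ⟨yD, hD⟩
  refine ⟨max (max yL yH) (max yS yD), fun δ hδ => ?_⟩
  have hyL : yL ≤ max (max yL yH) (max yS yD) := (le_max_left _ _).trans (le_max_left _ _)
  have hyH : yH ≤ max (max yL yH) (max yS yD) := (le_max_right _ _).trans (le_max_left _ _)
  have hyS : yS ≤ max (max yL yH) (max yS yD) := (le_max_left _ _).trans (le_max_right _ _)
  have hyD : yD ≤ max (max yL yH) (max yS yD) := (le_max_right _ _).trans (le_max_right _ _)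
  obtain ⟨KL, hKL, hL⟩ := hL δ hδ
  obtain ⟨KH, hKH, hH⟩ := hH δ hδ
  by_cases hδ3 : δ < 1 / 3
  · obtain ⟨KS, hKS, hS⟩ := hS δ hδ hδ3
    obtain ⟨KD, hKD, hD⟩ := hD δ hδ hδ3
    refine ⟨max (max KL KH) (max KS KD), lt_max_of_lt_left (lt_max_of_lt_left hKL),
      fun a b c ht => ?_⟩
    have hK0 : (0 : ℝ) ≤ max (max KL KH) (max KS KD) :=
      (lt_max_of_lt_left (lt_max_of_lt_left hKL) : (0 : ℝ) < _).le
    have hR0 : (0 : ℝ) ≤ ((Literature.NumberTheory.DiophantineGeometry.rad a b c : ℕ) : ℝ) ^ (1 + δ) :=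
      Real.rpow_nonneg (Nat.cast_nonneg _) _
    rcases le_or_gt (((min a b : ℕ) : ℝ)) ((c : ℝ) ^ (1 - δ)) with hlop | hbal
    · exact lift (hL a b c ht hlop) ((le_max_left _ _).trans (le_max_left _ _)) hK0
        (smoothPart_mono _ hyL) hR0
    by_cases hheavy : (c : ℝ) ^ δ ≤ ((∏ p ∈ (a * b * c).primeFactors with
        p ≤ ⌊((Literature.NumberTheory.DiophantineGeometry.rad a b c : ℕ) : ℝ) ^ δ⌋₊,
        p ^ (a * b * c).factorization p : ℕ) : ℝ)
    · exact lift (hH a b c ht hbal fun _ => hheavy) ((le_max_right _ _).trans (le_max_left _ _)) hK0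
        (smoothPart_mono _ hyH) hR0
    by_cases hshadow : ∀ a' b' c' : ℕ, Literature.NumberTheory.DiophantineGeometry.IsABCTriple a' b' c' →
        c' ≤ 4 * c ^ 3 →
        c * Literature.NumberTheory.DiophantineGeometry.rad a' b' c' ≤
          16 * Literature.NumberTheory.DiophantineGeometry.rad a b c * c' →
        (c' : ℝ) ^ (1 - δ) < ((min a' b' : ℕ) : ℝ) ∧
          ¬ (c' : ℝ) ^ δ ≤ ((∏ p ∈ (a' * b' * c').primeFactors with
            p ≤ ⌊((Literature.NumberTheory.DiophantineGeometry.rad a' b' c' : ℕ) : ℝ) ^ δ⌋₊,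
            p ^ (a' * b' * c').factorization p : ℕ) : ℝ)
    · exact lift (hS a b c ht hbal hheavy hshadow) ((le_max_left _ _).trans (le_max_right _ _)) hK0
        (smoothPart_mono _ hyS) hR0
    · exact lift (hD a b c ht hbal hheavy hshadow) ((le_max_right _ _).trans (le_max_right _ _)) hK0
        (smoothPart_mono _ hyD) hR0
  · refine ⟨max KL KH, lt_max_of_lt_left hKL, fun a b c ht => ?_⟩
    have hK0 : (0 : ℝ) ≤ max KL KH := (lt_max_of_lt_left hKL : (0 : ℝ) < _).le
    have hR0 : (0 : ℝ) ≤ ((Literature.NumberTheory.DiophantineGeometry.rad a b c : ℕ) : ℝ) ^ (1 + δ) :=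
      Real.rpow_nonneg (Nat.cast_nonneg _) _
    rcases le_or_gt (((min a b : ℕ) : ℝ)) ((c : ℝ) ^ (1 - δ)) with hlop | hbal
    · exact lift (hL a b c ht hlop) (le_max_left _ _) hK0 (smoothPart_mono _ hyL) hR0
    · exact lift (hH a b c ht hbal fun h => absurd h hδ3) (le_max_right _ _) hK0
        (smoothPart_mono _ hyH) hR0

end Summit.ABC.ABC.Theorems
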